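import Literature.NumberTheory.Sieve.MontgomeryVaughan1975MajorArcs
import HarnessLib

/-!
# Montgomery–Vaughan (1975), §8: the arithmetic of the case analysis — proved

H. L. Montgomery, R. C. Vaughan, *The exceptional set in Goldbach's problem*, Acta Arith. 27
(1975) 353–370 [MontgomeryVaughanActa1975], §8 (pp. 367–368) and the estimates of §6 it uses.
Theorems only; everything here is PROVED. This is the first half of the deduction of (8.3)
(`Literature.NumberTheory.Sieve.MontgomeryVaughan1975.majorArc_lowerBound`) from the major-arc
formulae (`Literature.NumberTheory.Sieve.MontgomeryVaughan1975.majorArc_formulae`); the assembly is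
in `MontgomeryVaughan1975Section8Assembly.lean`.

* `excPairSum_le`, `excPairSum_le_rpow` — (6.18) `Ĩ(n) ≤ X` and `Ĩ(n) ≤ n^{β̃}` (p. 364–365).
* `abs_excRatio_le` — **(8.5)** `|𝔖̃(n)| ≤ 𝔖(n) ∏_{p∣r̃, p∤n, p>3} (p−2)⁻¹`, in the ratio form
  `|𝔖̃(n)/𝔖(n)| ≤ ∏ …`, prime by prime from the structure of the exceptional modulus (Lemma 5.1:
  `r̃/(4, r̃)` square-free — `not_sq_dvd_of_isPrimitive`, `not_sixteen_dvd_of_isPrimitive`).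
* `prod_inv_sub_two_le_rpow`, `cast_div_totient_sq_le` — `∏_{p∣r̃,p>3}(p−2)⁻¹ ≤ (24/r̃)^{1/2}` and,
  for odd `r̃`, `r̃/φ(r̃)² ≤ ∏_{p∣r̃,p>3}(p−2)⁻¹` (the "`= o(1)`, since `r̃ ≫ log P`" of p. 367).
* `case_noExc`, `case_coprime`, `case_nonempty`, `case_empty` — the real-arithmetic core of the
  four cases of pp. 367–368 (no exceptional character; `(n,r̃) = 1`; `(n,r̃) > 1` with the product
  in (8.5) non-empty; the product empty, via (6.21)), each as an explicit inequality.
-/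

noncomputable section

open Finset MeasureTheory Filter
open scoped FourierTransform ArithmeticFunction.Moebius

namespace Literature.NumberTheory.Sieve.MontgomeryVaughan1975

/-! ### (6.18) and `Ĩ(n) ≤ n^{β̃}` -/

/-- The inner sum of `Ĩ(n)` over `k'` has at most the one term `k' = n − k`. [folklore] -/
theorem sum_ite_add_eq_le {s : Finset ℕ} {f : ℕ → ℝ} {a : ℝ} (ha : 0 ≤ a) (k n : ℕ)
    (hf : ∀ k' ∈ s, k + k' = n → f k' ≤ a) :
    (∑ k' ∈ s, if k + k' = n then f k' else 0) ≤ a := by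
  rw [← Finset.sum_filter]
  have hsub : s.filter (fun k' => k + k' = n) ⊆ {n - k} := by
    intro k' hk'
    rw [Finset.mem_filter] at hk'
    rw [Finset.mem_singleton]; omega
  calc ∑ k' ∈ s.filter (fun k' => k + k' = n), f k' ≤ ∑ k' ∈ s.filter (fun k' => k + k' = n), a :=
        Finset.sum_le_sum fun k' hk' => hf k' (Finset.mem_filter.mp hk').1 (Finset.mem_filter.mp hk').2
    _ = (s.filter (fun k' => k + k' = n)).card * a := by rw [Finset.sum_const, nsmul_eq_mul]
    _ ≤ 1 * a := by
        apply mul_le_mul_of_nonneg_right _ ha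
        exact_mod_cast (Finset.card_le_card hsub).trans (Finset.card_singleton _).le
    _ = a := one_mul a

/-- **(6.18)** `Ĩ(n) ≤ X` (Montgomery–Vaughan 1975, p. 364, "As in (6.7)"): each of the at most
`#{P < k ≤ X} ≤ X` terms `(k k')^{β̃−1}`, `k + k' = n`, is `≤ 1` for `β̃ ≤ 1`.
[cite: MontgomeryVaughanActa1975, §6 (6.18)] -/
theorem excPairSum_le {P X β : ℝ} (hX : 0 ≤ X) (hβ : β ≤ 1) (n : ℕ) : excPairSum P X β n ≤ X := by
  unfold excPairSum
  have hterm : ∀ k ∈ intWindow P X, ∀ k' ∈ intWindow P X, ((k : ℝ) * k') ^ (β - 1) ≤ 1 := by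
    intro k hk k' hk'
    have h1 : (1 : ℝ) ≤ k := by exact_mod_cast (mem_intWindow.mp hk).1.1
    have h2 : (1 : ℝ) ≤ k' := by exact_mod_cast (mem_intWindow.mp hk').1.1
    exact Real.rpow_le_one_of_one_le_of_nonpos (one_le_mul_of_one_le_of_one_le h1 h2) (by linarith)
  calc _ ≤ ∑ k ∈ intWindow P X, (1 : ℝ) :=
        Finset.sum_le_sum fun k hk => sum_ite_add_eq_le zero_le_one k n fun k' hk' _ => hterm k hk k' hk'
    _ = (intWindow P X).card := by rw [Finset.sum_const, nsmul_eq_mul, mul_one]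
    _ ≤ X := card_intWindow_le hX

/-- **`Ĩ(n) ≤ n^{β̃}`** (Montgomery–Vaughan 1975, p. 365: "Clearly
`Ĩ(n) = ∑_{P<k<n−P} (k(n−k))^{β̃−1} ≤ n · n^{β̃−1} = n^{β̃}`"): for `P ≥ 2` the terms have
`k, k' ≥ 3`, so `k k' ≥ k + k' = n` and `(k k')^{β̃−1} ≤ n^{β̃−1}`, and there are fewer than `n` of them.
[cite: MontgomeryVaughanActa1975, §6 (6.21)] -/
theorem excPairSum_le_rpow {P X β : ℝ} (hP : 2 ≤ P) (hβ0 : 0 < β) (hβ : β ≤ 1) (n : ℕ) :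
    excPairSum P X β n ≤ (n : ℝ) ^ β := by
  unfold excPairSum
  rcases Nat.eq_zero_or_pos n with hn | hn
  · subst hn
    have : ∀ k ∈ intWindow P X, ∀ k' ∈ intWindow P X, ¬ (k + k' = 0) := by
      intro k hk k' _ h
      have := (mem_intWindow.mp hk).1.1; omega
    rw [Finset.sum_eq_zero fun k hk => Finset.sum_eq_zero fun k' hk' => if_neg (this k hk k' hk')]
    exact Real.rpow_nonneg (Nat.cast_nonneg 0) β
  have hn0 : (0 : ℝ) < n := by exact_mod_cast hn
  -- each term is at most `n^{β-1}`
  have hterm : ∀ k ∈ intWindow P X, ∀ k' ∈ intWindow P X, k + k' = n →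
      ((k : ℝ) * k') ^ (β - 1) ≤ (n : ℝ) ^ (β - 1) := by
    intro k hk k' hk' hkk
    have hk2 : (2 : ℝ) < k := lt_of_le_of_lt hP (mem_intWindow.mp hk).2
    have hk2' : (2 : ℝ) < k' := lt_of_le_of_lt hP (mem_intWindow.mp hk').2
    have hle : (n : ℝ) ≤ (k : ℝ) * k' := by
      have : ((k + k' : ℕ) : ℝ) = n := by rw [hkk]
      push_cast at this
      nlinarith
    exact Real.rpow_le_rpow_of_nonpos hn0 hle (by linarith)
  -- only `k < n` contribute
  have hvan : ∀ k ∈ intWindow P X, ¬ k < n → (∑ k' ∈ intWindow P X,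
      if k + k' = n then ((k : ℝ) * k') ^ (β - 1) else 0) = 0 := by
    intro k _ hk
    refine Finset.sum_eq_zero fun k' hk' => if_neg fun h => ?_
    have := (mem_intWindow.mp hk').1.1; omega
  rw [← Finset.sum_filter_add_sum_filter_not (intWindow P X) (fun k => k < n),
    Finset.sum_eq_zero fun k hk => hvan k (Finset.mem_filter.mp hk).1 (Finset.mem_filter.mp hk).2,
    add_zero]
  calc _ ≤ ∑ k ∈ (intWindow P X).filter (fun k => k < n), (n : ℝ) ^ (β - 1) := by
        exact Finset.sum_le_sum fun k hk => sum_ite_add_eq_le (Real.rpow_nonneg hn0.le _) k n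
          fun k' hk' hkk => hterm k (Finset.mem_filter.mp hk).1 k' hk' hkk
    _ ≤ (n : ℝ) * (n : ℝ) ^ (β - 1) := by
        rw [Finset.sum_const, nsmul_eq_mul]
        apply mul_le_mul_of_nonneg_right _ (Real.rpow_nonneg hn0.le _)
        have : ((intWindow P X).filter (fun k => k < n)).card ≤ (Finset.range n).card :=
          Finset.card_le_card fun k hk => Finset.mem_range.mpr (Finset.mem_filter.mp hk).2
        rw [Finset.card_range] at this
        exact_mod_cast this
    _ = (n : ℝ) ^ β := by
        rw [← Real.rpow_one_add' hn0.le (by linarith)]; ring_nf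


/-! ### (8.5) -/

/-- The local factors of (6.16) are positive at every prime as soon as `n` is even. [folklore] -/
theorem singSeriesLocalFactor_pos {n p : ℕ} (hn : Even n) (hp : p.Prime) : 0 < singSeriesLocalFactor n p := by
  unfold singSeriesLocalFactor
  have hp2 : (2 : ℝ) ≤ p := by exact_mod_cast hp.two_le
  split_ifs with hdvd
  · have : (0 : ℝ) < (p : ℝ) - 1 := by linarith
    positivity
  · -- `p ∤ n` with `n` even forces `p ≠ 2`, so `p ≥ 3` and `1/(p-1)² ≤ 1/4`
    have hp3 : (3 : ℝ) ≤ p := by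
      have : p ≠ 2 := fun h => hdvd (h ▸ even_iff_two_dvd.mp hn)
      exact_mod_cast lt_of_le_of_ne hp.two_le (Ne.symm this)
    have h4 : (4 : ℝ) ≤ ((p : ℝ) - 1) ^ 2 := by nlinarith
    have : 1 / ((p : ℝ) - 1) ^ 2 ≤ 1 / 4 := div_le_div_of_nonneg_left zero_le_one (by norm_num) h4
    linarith

/-- `v_p(r/(r,n)) = v_p(r) − min(v_p(r), v_p(n))`. [folklore] -/
theorem factorization_div_gcd {r n : ℕ} (hr : r ≠ 0) (hn : n ≠ 0) (p : ℕ) :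
    (r / Nat.gcd r n).factorization p = r.factorization p - min (r.factorization p) (n.factorization p) := by
  rw [Nat.factorization_div (Nat.gcd_dvd_left r n), Finsupp.tsub_apply, Nat.factorization_gcd hr hn,
    Finsupp.inf_apply]

/-- **(8.5) in ratio form** (Montgomery–Vaughan 1975, p. 368: "From (6.1͂6) and (6.16), we see that
`|𝔖̃(n)| ≤ 𝔖(n) ∏_{p∣r̃, p∤n, p>3} (p − 2)⁻¹`"): for a primitive quadratic `χ̃` mod `r̃` and even
`n ≠ 0`, `|𝔖̃(n)/𝔖(n)| = |excRatio χ̃ n| ≤ ∏_{p∣r̃, p∤n, p>3} (p − 2)⁻¹`. Prime by prime over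
`p ∣ r̃`, with `v_p(r̃) ≤ 1` for odd `p` and `v₂(r̃) ≤ 3` (Lemma 5.1: `r̃/(4, r̃)` is square-free;
`not_sq_dvd_of_isPrimitive`, `not_sixteen_dvd_of_isPrimitive`): the factor of
`r̃ φ(r̃)⁻¹ φ(r̃/(r̃,n))⁻¹ / (local factor of 𝔖)` at an odd `p` is `1` if `p ∣ n` and `(p−2)⁻¹` if
`p ∤ n`, and at `p = 2` it is `≤ 1`. [cite: MontgomeryVaughanActa1975, §8 (8.5)] -/
theorem abs_excRatio_le {r : ℕ} [NeZero r] {χ : DirichletCharacter ℂ r} (hχ : χ.IsPrimitive)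
    (h2 : χ ^ 2 = 1) {n : ℕ} (hn : Even n) (hn0 : n ≠ 0) :
    |excRatio χ n| ≤ ∏ p ∈ r.primeFactors.filter (fun p => ¬ p ∣ n ∧ 3 < p), ((p : ℝ) - 2)⁻¹ := by
  have hr : r ≠ 0 := NeZero.ne r
  set S := r.primeFactors with hS
  set g := Nat.gcd r n with hg
  set s := r / g with hs
  have hg0 : 0 < g := Nat.gcd_pos_of_pos_left n (Nat.pos_of_ne_zero hr)
  have hgr : g ∣ r := Nat.gcd_dvd_left r n
  have hs0 : s ≠ 0 := by
    rw [hs]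
    exact (Nat.div_pos (Nat.le_of_dvd (Nat.pos_of_ne_zero hr) hgr) hg0).ne'
  have hsr : s ∣ r := Nat.div_dvd_of_dvd hgr
  have hsS : s.primeFactors ⊆ S := Nat.primeFactors_mono hsr hr
  have hprime : ∀ p ∈ S, p.Prime := fun p hp => Nat.prime_of_mem_primeFactors hp
  -- positivity of the pieces
  have hD : 0 < ∏ p ∈ S, singSeriesLocalFactor n p :=
    Finset.prod_pos fun p hp => singSeriesLocalFactor_pos hn (hprime p hp)
  have hφr : (0 : ℝ) < Nat.totient r := by exact_mod_cast Nat.totient_pos.mpr (Nat.pos_of_ne_zero hr)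
  have hφs : (0 : ℝ) < Nat.totient s := by exact_mod_cast Nat.totient_pos.mpr (Nat.pos_of_ne_zero hs0)
  -- Step 1: `|ρ| ≤ (r / (φ r φ s)) / D`
  have h1 : |excRatio χ n| ≤ ((r : ℝ) / ((Nat.totient r : ℝ) * Nat.totient s)) /
      ∏ p ∈ S, singSeriesLocalFactor n p := by
    unfold excRatio
    rw [← hg, ← hs, abs_div, abs_of_pos hD, abs_mul, abs_mul]
    apply div_le_div_of_nonneg_right _ hD.le
    have hre : |(χ (-1)).re| ≤ 1 := by
      refine (Complex.abs_re_le_norm _).trans ?_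
      have hu : IsUnit (-1 : ZMod r) := isUnit_one.neg
      rw [← hu.unit_spec, χ.unit_norm_eq_one hu.unit]
    have hμ : |((μ s : ℤ) : ℝ)| ≤ 1 := by exact_mod_cast ArithmeticFunction.abs_moebius_le_one
    have hq : 0 ≤ (r : ℝ) / ((Nat.totient r : ℝ) * Nat.totient s) := by positivity
    rw [abs_of_nonneg hq]
    calc |(χ (-1)).re| * |((μ s : ℤ) : ℝ)| * ((r : ℝ) / ((Nat.totient r : ℝ) * Nat.totient s))
        ≤ 1 * 1 * ((r : ℝ) / ((Nat.totient r : ℝ) * Nat.totient s)) := by gcongr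
      _ = _ := by ring
  refine h1.trans ?_
  rw [div_le_iff₀ hD, div_le_iff₀ (mul_pos hφr hφs)]
  -- Step 2: write everything as products over `S`
  set c : ℕ → ℝ := fun p => if ¬ p ∣ n ∧ 3 < p then ((p : ℝ) - 2)⁻¹ else 1 with hc
  have hcprod : ∏ p ∈ S.filter (fun p => ¬ p ∣ n ∧ 3 < p), ((p : ℝ) - 2)⁻¹ = ∏ p ∈ S, c p := by
    rw [Finset.prod_filter]
  rw [hcprod, ← Finset.prod_mul_distrib,
    cast_eq_prod_pow_factorization hr (subset_refl S), totient_cast_eq_prod hr (subset_refl S),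
    totient_cast_eq_prod hs0 hsS, ← Finset.prod_mul_distrib, ← Finset.prod_mul_distrib]
  -- Step 3: prime by prime
  refine Finset.prod_le_prod (fun p _ => by positivity) fun p hp => ?_
  have hpp := hprime p hp
  have hp2 : (2 : ℝ) ≤ p := by exact_mod_cast hpp.two_le
  have hpS : p ∈ r.primeFactors := hp
  rw [if_pos hpS]
  -- the exponents
  set a := r.factorization p with ha
  set b := s.factorization p with hb
  have ha1 : 1 ≤ a := (mem_primeFactors_iff_one_le hr hpp).mp hp
  have hbv : b = a - min a (n.factorization p) := by rw [hb, hs, hg, factorization_div_gcd hr hn0]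
  have hmem : p ∈ s.primeFactors ↔ 1 ≤ b := mem_primeFactors_iff_one_le hs0 hpp
  by_cases hp2' : p = 2
  · -- `p = 2`: `a ≤ 3`, `2 ∣ n`, local factor `2`, `c = 1`, `b ≤ a - 1`
    subst hp2'
    have hdvd : 2 ∣ n := even_iff_two_dvd.mp hn
    have hv : 1 ≤ n.factorization 2 := (Nat.prime_two.dvd_iff_one_le_factorization hn0).mp hdvd
    have hba : b + 1 ≤ a := by omega
    have hloc : singSeriesLocalFactor n 2 = 2 := by
      rw [singSeriesLocalFactor, if_pos hdvd]; norm_num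
    have hc2 : c 2 = 1 := by rw [hc]; simp [hdvd]
    rw [hloc, hc2]
    push_cast
    have key : (2 : ℝ) ^ a = 2 * 2 ^ (a - 1) := by
      rw [← pow_succ']; congr 1; omega
    have hite : (1 : ℝ) ≤ (if 2 ∈ s.primeFactors then (2 : ℝ) ^ (b - 1) * (2 - 1) else 1) := by
      split_ifs
      · norm_num; exact one_le_pow₀ (by norm_num)
      · exact le_rfl
    calc (2 : ℝ) ^ a = 1 * 2 * (2 ^ (a - 1) * (2 - 1) * 1) := by rw [key]; ring
      _ ≤ 1 * 2 * (2 ^ (a - 1) * (2 - 1) *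
          (if 2 ∈ s.primeFactors then (2 : ℝ) ^ (b - 1) * (2 - 1) else 1)) := by gcongr
  · -- odd `p`: `a = 1`
    have ha : a = 1 := by
      have : ¬ p ^ 2 ∣ r := not_sq_dvd_of_isPrimitive hχ h2 hpp hp2'
      have : ¬ 2 ≤ a := fun h => this ((hpp.pow_dvd_iff_le_factorization hr).mpr h)
      omega
    have hp3 : (3 : ℝ) ≤ p := by
      exact_mod_cast lt_of_le_of_ne hpp.two_le (Ne.symm hp2')
    rw [ha]
    simp only [le_refl, tsub_eq_zero_of_le, pow_zero, one_mul, pow_one]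
    by_cases hdvd : p ∣ n
    · -- `p ∣ n`: `b = 0`, factor `p/(p-1)`, `c = 1`
      have hv : 1 ≤ n.factorization p := (hpp.dvd_iff_one_le_factorization hn0).mp hdvd
      have hb0 : b = 0 := by rw [hbv, ha]; omega
      have hns : p ∉ s.primeFactors := fun h => by have := hmem.mp h; omega
      have hloc : singSeriesLocalFactor n p = 1 + 1 / ((p : ℝ) - 1) := by
        rw [singSeriesLocalFactor, if_pos hdvd]
      have hcp : c p = 1 := by rw [hc]; simp [hdvd]
      rw [if_neg hns, hloc, hcp]
      have : (p : ℝ) - 1 ≠ 0 := by linarith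
      field_simp
      nlinarith
    · -- `p ∤ n`: `b = 1`, factor `1 - 1/(p-1)²`, `c = (p-2)⁻¹` for `p > 3`, `1` for `p = 3`
      have hv : n.factorization p = 0 := Nat.factorization_eq_zero_of_not_dvd hdvd
      have hb1 : b = 1 := by rw [hbv, ha, hv]; simp
      have hsmem : p ∈ s.primeFactors := hmem.mpr (by omega)
      have hloc : singSeriesLocalFactor n p = 1 - 1 / ((p : ℝ) - 1) ^ 2 := by
        rw [singSeriesLocalFactor, if_neg hdvd]
      rw [if_pos hsmem, hloc, hb1]
      simp only [le_refl, tsub_eq_zero_of_le, pow_zero, one_mul]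
      have hp1 : (p : ℝ) - 1 ≠ 0 := by linarith
      by_cases hp3' : 3 < p
      · have hcp : c p = ((p : ℝ) - 2)⁻¹ := by rw [hc]; simp [hdvd, hp3']
        rw [hcp]
        have hp4 : (4 : ℝ) ≤ p := by exact_mod_cast hp3'
        have hp2'' : (p : ℝ) - 2 ≠ 0 := by linarith
        calc (p : ℝ) = ((p : ℝ) - 2)⁻¹ * (1 - 1 / ((p : ℝ) - 1) ^ 2) * (((p : ℝ) - 1) * ((p : ℝ) - 1)) := by
              field_simp; ring
          _ ≤ _ := le_of_eq (by ring)
      · have hp3eq : (p : ℝ) = 3 := by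
          have : p ≤ 3 := not_lt.mp hp3'
          have h3 : 3 ≤ p := by exact_mod_cast hp3
          exact_mod_cast le_antisymm this h3
        have hcp : c p = 1 := by rw [hc]; simp [hdvd, hp3']
        rw [hcp, hp3eq]
        norm_num


/-! ### The size of the exceptional-modulus corrections -/

/-- `π(r) = ∏_{p ∣ r, p > 3} (p − 2)⁻¹ ≤ (24/r)^{1/2}` for the conductor `r` of a primitive quadratic
character: `(p−2)² ≥ p` for `p ≥ 5` and `r ≤ 24 ∏_{p∣r,p>3} p` (Montgomery–Vaughan 1975, p. 367:
"it follows from Lemma 4.1 that `r̃ ≫ log P`", so these corrections are `o(1)`).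
[cite: MontgomeryVaughanActa1975, §8 (8.5)] -/
theorem prod_inv_sub_two_le_rpow {r : ℕ} [NeZero r] {χ : DirichletCharacter ℂ r}
    (hχ : χ.IsPrimitive) (h2 : χ ^ 2 = 1) :
    ∏ p ∈ r.primeFactors.filter (3 < ·), ((p : ℝ) - 2)⁻¹ ≤ (24 / (r : ℝ)) ^ (1 / 2 : ℝ) := by
  have hr : r ≠ 0 := NeZero.ne r
  have hr0 : (0 : ℝ) < r := by exact_mod_cast Nat.pos_of_ne_zero hr
  set T := r.primeFactors.filter (3 < ·) with hT
  set r' : ℕ := ∏ p ∈ T, p with hr'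
  have hTprime : ∀ p ∈ T, p.Prime := fun p hp => Nat.prime_of_mem_primeFactors (Finset.mem_filter.mp hp).1
  have hr'0 : (0 : ℝ) < r' := by
    rw [hr']; push_cast
    exact Finset.prod_pos fun p hp => by exact_mod_cast (hTprime p hp).pos
  -- `r ≤ 24 r'`
  have hdvd := dvd_mul_prod_primeFactors_of_isPrimitive hχ h2
  have hle : (r : ℝ) ≤ 24 * r' := by
    have hpos : 0 < 24 * ∏ p ∈ T, p :=
      Nat.mul_pos (by norm_num) (Finset.prod_pos fun p hp => (hTprime p hp).pos)
    have := Nat.le_of_dvd hpos hdvd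
    rw [hr']; exact_mod_cast this
  -- termwise `(p-2)⁻¹ ≤ p^{-1/2}`
  have hterm : ∀ p ∈ T, ((p : ℝ) - 2)⁻¹ ≤ (p : ℝ) ^ (-(1 / 2 : ℝ)) := by
    intro p hp
    have hp5 : (4 : ℝ) ≤ p := by exact_mod_cast (Finset.mem_filter.mp hp).2
    have hp0 : (0 : ℝ) < p := by linarith
    rw [Real.rpow_neg hp0.le, ← Real.sqrt_eq_rpow]
    have hsq : Real.sqrt p ≤ (p : ℝ) - 2 := by
      rw [Real.sqrt_le_left (by linarith)]
      nlinarith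
    exact inv_anti₀ (Real.sqrt_pos.mpr hp0) hsq
  calc ∏ p ∈ T, ((p : ℝ) - 2)⁻¹ ≤ ∏ p ∈ T, (p : ℝ) ^ (-(1 / 2 : ℝ)) :=
        Finset.prod_le_prod (fun p hp => by
          have : (4 : ℝ) ≤ p := by exact_mod_cast (Finset.mem_filter.mp hp).2
          exact inv_nonneg.mpr (by linarith)) hterm
    _ = (r' : ℝ) ^ (-(1 / 2 : ℝ)) := by
        rw [hr']; push_cast
        rw [Real.finsetProd_rpow _ _ fun p hp => by exact_mod_cast (hTprime p hp).pos.le]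
    _ ≤ ((r : ℝ) / 24) ^ (-(1 / 2 : ℝ)) :=
        Real.rpow_le_rpow_of_nonpos (by positivity) (by linarith) (by norm_num)
    _ = (24 / (r : ℝ)) ^ (1 / 2 : ℝ) := by
        rw [Real.rpow_neg (by positivity), ← Real.inv_rpow (by positivity), inv_div]

/-- For odd `r` with `p² ∤ r` for all odd primes `p` (the odd conductor of a primitive quadratic
character): `r/φ(r)² = ∏_{p∣r} p/(p−1)² ≤ ∏_{p∣r, p>3} (p−2)⁻¹` (`p(p−2) ≤ (p−1)²`, and `3/4 ≤ 1`).
This is the comparison behind `𝔖̃(n) ≪ nφ(n)⁻¹ r̃ φ(r̃)⁻²` on p. 367 of Montgomery–Vaughan 1975.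
[cite: MontgomeryVaughanActa1975, §8 (8.4)] -/
theorem cast_div_totient_sq_le {r : ℕ} [NeZero r] {χ : DirichletCharacter ℂ r}
    (hχ : χ.IsPrimitive) (h2 : χ ^ 2 = 1) (hodd : Odd r) :
    (r : ℝ) / (Nat.totient r : ℝ) ^ 2 ≤ ∏ p ∈ r.primeFactors.filter (3 < ·), ((p : ℝ) - 2)⁻¹ := by
  have hr : r ≠ 0 := NeZero.ne r
  set S := r.primeFactors with hS
  have hprime : ∀ p ∈ S, p.Prime := fun p hp => Nat.prime_of_mem_primeFactors hp
  have hφ : (0 : ℝ) < Nat.totient r := by exact_mod_cast Nat.totient_pos.mpr (Nat.pos_of_ne_zero hr)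
  rw [div_le_iff₀ (pow_pos hφ 2)]
  set c : ℕ → ℝ := fun p => if 3 < p then ((p : ℝ) - 2)⁻¹ else 1 with hc
  rw [show ∏ p ∈ S.filter (3 < ·), ((p : ℝ) - 2)⁻¹ = ∏ p ∈ S, c p from Finset.prod_filter _ _]
  rw [cast_eq_prod_pow_factorization hr (subset_refl S), totient_cast_eq_prod hr (subset_refl S),
    ← Finset.prod_pow, ← Finset.prod_mul_distrib]
  refine Finset.prod_le_prod (fun p _ => by positivity) fun p hp => ?_
  have hpp := hprime p hp
  have hp2 : p ≠ 2 := by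
    rintro rfl
    exact (Nat.not_even_iff_odd.mpr hodd) (even_iff_two_dvd.mpr (Nat.dvd_of_mem_primeFactors hp))
  have ha : r.factorization p = 1 := by
    have h1 : 1 ≤ r.factorization p := (mem_primeFactors_iff_one_le hr hpp).mp hp
    have : ¬ p ^ 2 ∣ r := not_sq_dvd_of_isPrimitive hχ h2 hpp hp2
    have : ¬ 2 ≤ r.factorization p := fun h => this ((hpp.pow_dvd_iff_le_factorization hr).mpr h)
    omega
  have hp3 : (3 : ℝ) ≤ p := by exact_mod_cast lt_of_le_of_ne hpp.two_le (Ne.symm hp2)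
  rw [if_pos hp, ha]
  simp only [le_refl, tsub_eq_zero_of_le, pow_zero, one_mul, pow_one]
  by_cases hp3' : 3 < p
  · have hcp : c p = ((p : ℝ) - 2)⁻¹ := by rw [hc]; simp [hp3']
    rw [hcp]
    have hp4 : (4 : ℝ) ≤ p := by exact_mod_cast hp3'
    have hp2'' : (0 : ℝ) < (p : ℝ) - 2 := by linarith
    rw [← div_eq_inv_mul, le_div_iff₀ hp2'']
    nlinarith
  · have hcp : c p = 1 := by rw [hc]; simp [hp3']
    rw [hcp]
    nlinarith


/-! ### The real-arithmetic core of the four cases of §8 -/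

/-- From `‖z − m‖ ≤ E` to `m − E ≤ Re z`. [folklore] -/
theorem re_ge_of_norm_sub_le {z : ℂ} {m E : ℝ} (h : ‖z - (m : ℂ)‖ ≤ E) : m - E ≤ z.re := by
  have h1 : |(z - (m : ℂ)).re| ≤ ‖z - (m : ℂ)‖ := Complex.abs_re_le_norm _
  rw [Complex.sub_re, Complex.ofReal_re] at h1
  have := (abs_le.mp (h1.trans h)).1
  linarith

/-- No exceptional character (M–V p. 367): `R₁(n) = 𝔖(n)n + O(nφ(n)⁻¹X e^{−c/δ}) ≫ nφ(n)⁻¹X ≫ X`.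
Pure arithmetic: `𝔖 ≥ C₂ t`, `t = n/φ(n) ≥ 1`, `n > X/2`, `C ε ≤ C₂/8`, `C E ≤ C₂X/8` give
`𝔖 n − C (E + t X ε) ≥ C₂ X / 8`. [cite: MontgomeryVaughanActa1975, §8 (8.3)] -/
theorem case_noExc {𝔖 t n X ε E C C₂ : ℝ} (hC₂ : 0 < C₂) (hX : 0 < X) (ht : 1 ≤ t)
    (h𝔖 : C₂ * t ≤ 𝔖) (hn : X / 2 < n) (hε : C * ε ≤ C₂ / 8)
    (hE : C * E ≤ C₂ * X / 8) : C₂ * X / 8 ≤ 𝔖 * n - C * (E + t * X * ε) := by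
  have h1 : C₂ * t * (X / 2) ≤ 𝔖 * n := by
    have : 0 ≤ 𝔖 := le_trans (by positivity) h𝔖
    nlinarith
  have h2 : C * (t * X * ε) ≤ t * X * (C₂ / 8) := by
    have : C * (t * X * ε) = t * X * (C * ε) := by ring
    rw [this]; exact mul_le_mul_of_nonneg_left hε (by positivity)
  have htX : C₂ * X ≤ C₂ * (t * X) := mul_le_mul_of_nonneg_left (by nlinarith) hC₂.le
  nlinarith

/-- Case `(n, r̃) = 1` (M–V p. 367: `𝔖̃(n) ≪ nφ(n)⁻¹ r̃ φ(r̃)⁻² = o(1)` … `R₁(n) ≫ X`): with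
`|ρ| ≤ θ`, `0 ≤ Ĩ ≤ X`, `E₁ ≤ θ t X`, `θ ≤ 1/8`, `C θ ≤ C₂/16`, `C E₂ ≤ C₂ X/16`, `C κ ≤ C₂/16`
(`κ = (1−β̃) log P · e^{−c/δ} ≤ c₁ ε`): `𝔖(n + ρ Ĩ) − C(E₁ + E₂ + t X κ) ≥ C₂ X/8`.
[cite: MontgomeryVaughanActa1975, §8 (8.4)] -/
theorem case_coprime {𝔖 t n X ρ I θ E₁ E₂ L e C C₂ : ℝ} (hC₂ : 0 < C₂) (hC : 0 ≤ C) (hX : 0 < X)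
    (ht : 1 ≤ t) (h𝔖 : C₂ * t ≤ 𝔖) (hn : X / 2 < n) (hρ : |ρ| ≤ θ) (hI0 : 0 ≤ I) (hI : I ≤ X)
    (hE₁ : E₁ ≤ θ * t * X) (hθ : θ ≤ 1 / 8) (hCθ : C * θ ≤ C₂ / 16) (hE₂ : C * E₂ ≤ C₂ * X / 16)
    (hκ : C * (L * e) ≤ C₂ / 16) :
    C₂ * X / 8 ≤ 𝔖 * (n + ρ * I) - C * (E₁ + E₂ + t * X * L * e) := by
  set κ := L * e with hκdef
  rw [show t * X * L * e = t * X * κ by rw [hκdef]; ring]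
  have h𝔖0 : 0 ≤ 𝔖 := le_trans (by positivity) h𝔖
  have hθ0 : 0 ≤ θ := (abs_nonneg ρ).trans hρ
  -- main term: `n + ρ I ≥ X/2 − θ X ≥ 3X/8`
  have hρI : -(θ * X) ≤ ρ * I := by
    have : |ρ * I| ≤ θ * X := by
      rw [abs_mul, abs_of_nonneg hI0]; exact mul_le_mul hρ hI hI0 hθ0
    exact (abs_le.mp this).1
  have hmain : 𝔖 * (3 * X / 8) ≤ 𝔖 * (n + ρ * I) := by
    apply mul_le_mul_of_nonneg_left _ h𝔖0; nlinarith
  have h1 : C₂ * t * (3 * X / 8) ≤ 𝔖 * (3 * X / 8) := by nlinarith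
  -- error terms
  have h2 : C * E₁ ≤ t * X * (C₂ / 16) := by
    calc C * E₁ ≤ C * (θ * t * X) := mul_le_mul_of_nonneg_left hE₁ hC
      _ = t * X * (C * θ) := by ring
      _ ≤ t * X * (C₂ / 16) := mul_le_mul_of_nonneg_left hCθ (by positivity)
  have h3 : C * (t * X * κ) ≤ t * X * (C₂ / 16) := by
    calc C * (t * X * κ) = t * X * (C * κ) := by ring
      _ ≤ t * X * (C₂ / 16) := mul_le_mul_of_nonneg_left hκ (by positivity)
  have htX : C₂ * X ≤ C₂ * (t * X) := mul_le_mul_of_nonneg_left (by nlinarith) hC₂.le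
  nlinarith

/-- Case `(n, r̃) > 1`, product non-empty (M–V p. 368: `|𝔖̃| ≤ 𝔖/3`, `Ĩ ≤ X`, "as before
`R₁(n) ≫ nφ(n)⁻¹X ≫ X`"): `𝔖(n + ρĨ) − C(0 + E₂ + tXκ) ≥ C₂X/24` when `|ρ| ≤ 1/3`, `C E₂ ≤ C₂X/24`,
`Cκ ≤ C₂/12`. [cite: MontgomeryVaughanActa1975, §8 (8.5)] -/
theorem case_nonempty {𝔖 t n X ρ I E₂ L e C C₂ : ℝ} (hC₂ : 0 < C₂) (hX : 0 < X)
    (ht : 1 ≤ t) (h𝔖 : C₂ * t ≤ 𝔖) (hn : X / 2 < n) (hρ : |ρ| ≤ 1 / 3) (hI0 : 0 ≤ I) (hI : I ≤ X)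
    (hE₂ : C * E₂ ≤ C₂ * X / 24) (hκ : C * (L * e) ≤ C₂ / 12) :
    C₂ * X / 24 ≤ 𝔖 * (n + ρ * I) - C * (0 + E₂ + t * X * L * e) := by
  set κ := L * e with hκdef
  rw [show t * X * L * e = t * X * κ by rw [hκdef]; ring]
  have h𝔖0 : 0 ≤ 𝔖 := le_trans (by positivity) h𝔖
  have hρI : -(X / 3) ≤ ρ * I := by
    have : |ρ * I| ≤ 1 / 3 * X := by
      rw [abs_mul, abs_of_nonneg hI0]; exact mul_le_mul hρ hI hI0 (by norm_num)
    have := (abs_le.mp this).1; linarith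
  have hmain : 𝔖 * (X / 6) ≤ 𝔖 * (n + ρ * I) := by
    apply mul_le_mul_of_nonneg_left _ h𝔖0; nlinarith
  have h1 : C₂ * t * (X / 6) ≤ 𝔖 * (X / 6) := by nlinarith
  have h3 : C * (t * X * κ) ≤ t * X * (C₂ / 12) := by
    calc C * (t * X * κ) = t * X * (C * κ) := by ring
      _ ≤ t * X * (C₂ / 12) := mul_le_mul_of_nonneg_left hκ (by positivity)
  have htX : C₂ * X ≤ C₂ * (t * X) := mul_le_mul_of_nonneg_left (by nlinarith) hC₂.le
  nlinarith

/-- Case `(n, r̃) > 1`, product empty (M–V p. 368, via (6.21)): with `|ρ| ≤ 1`, `0 ≤ Ĩ ≤ n^{β̃}`,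
`n − n^{β̃} ≥ m n` and `m ≥ c₅ L` (`L = (1 − β̃) log P`), `t X L e ≤ 2 t n L e`, `C e ≤ c₅ C₂/4`:
`𝔖(n + ρĨ) − C(0 + E₂ + t X L e) ≥ (c₅ C₂/4) X L − C E₂`. [cite: MontgomeryVaughanActa1975, §8 (8.6)] -/
theorem case_empty {𝔖 t n X ρ I nβ m c₅ L e E₂ C C₂ : ℝ} (hC₂ : 0 < C₂) (hC : 0 ≤ C) (hX : 0 < X)
    (ht : 1 ≤ t) (h𝔖 : C₂ * t ≤ 𝔖) (hn : X / 2 < n) (hρ : |ρ| ≤ 1) (hI0 : 0 ≤ I)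
    (hI : I ≤ nβ) (hnβ : nβ ≤ n - m * n) (hm : c₅ * L ≤ m) (hL : 0 ≤ L) (hc₅ : 0 ≤ c₅)
    (he0 : 0 ≤ e) (he : C * e ≤ c₅ * C₂ / 4) :
    c₅ * C₂ / 4 * X * L - C * E₂ ≤ 𝔖 * (n + ρ * I) - C * (0 + E₂ + t * X * L * e) := by
  have h𝔖0 : 0 ≤ 𝔖 := le_trans (by positivity) h𝔖
  have hn0 : 0 ≤ n := by linarith
  -- main term `n + ρ I ≥ n − I ≥ m n ≥ c₅ L n`
  have hρI : -I ≤ ρ * I := by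
    have : |ρ * I| ≤ 1 * I := by
      rw [abs_mul, abs_of_nonneg hI0]; exact mul_le_mul_of_nonneg_right hρ hI0
    have := (abs_le.mp this).1; linarith
  have hmn : c₅ * L * n ≤ n + ρ * I := by
    have : c₅ * L * n ≤ m * n := mul_le_mul_of_nonneg_right hm hn0
    linarith
  have hmain : 𝔖 * (c₅ * L * n) ≤ 𝔖 * (n + ρ * I) := mul_le_mul_of_nonneg_left hmn h𝔖0
  have h1 : C₂ * t * (c₅ * L * n) ≤ 𝔖 * (c₅ * L * n) :=
    mul_le_mul_of_nonneg_right h𝔖 (by positivity)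
  -- error `C t X L e ≤ 2 C t n L e ≤ (c₅ C₂/2) t n L`
  have h3 : C * (t * X * L * e) ≤ t * n * L * (c₅ * C₂ / 2) := by
    calc C * (t * X * L * e) = t * X * L * (C * e) := by ring
      _ ≤ t * (2 * n) * L * (c₅ * C₂ / 4) := by
          apply mul_le_mul _ he (by positivity) (by positivity)
          exact mul_le_mul_of_nonneg_right (mul_le_mul_of_nonneg_left (by linarith) (by positivity)) hL
      _ = t * n * L * (c₅ * C₂ / 2) := by ring
  -- `t ≥ 1`, `n ≥ X/2`
  have h4 : c₅ * C₂ / 4 * X * L ≤ C₂ * t * (c₅ * L * n) - t * n * L * (c₅ * C₂ / 2) := by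
    have : C₂ * t * (c₅ * L * n) - t * n * L * (c₅ * C₂ / 2) = (c₅ * C₂ / 2) * (t * (n * L)) := by ring
    rw [this]
    have hnL : X / 2 * L ≤ t * (n * L) := by
      calc X / 2 * L ≤ n * L := mul_le_mul_of_nonneg_right hn.le hL
        _ = 1 * (n * L) := by ring
        _ ≤ t * (n * L) := mul_le_mul_of_nonneg_right ht (by positivity)
    have hcc : 0 ≤ c₅ * C₂ / 2 := by positivity
    have := mul_le_mul_of_nonneg_left hnL hcc
    linarith
  nlinarith


end Literature.NumberTheory.Sieve.MontgomeryVaughan1975
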